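import Mathlib.Analysis.InnerProductSpace.Projection.Reflection
import Mathlib.Analysis.InnerProductSpace.Projection.Submodule
import Mathlib.Topology.Algebra.Module.FiniteDimension
import HarnessLib

/-!
# No proper non-zero subspace of a finite-dimensional inner product space is invariant under all linear
# isometries

For a submodule `K` of a finite-dimensional inner product space `E` over `𝕜 = ℝ` or `ℂ` with `K ≠ ⊥` and
`K ≠ ⊤` there is a linear isometry `g : E ≃ₗᵢ[𝕜] E` and `v ∈ K` with `g v ∉ K`
(`exists_linearIsometryEquiv_apply_not_mem`); equivalently the unitary / orthogonal group `U(E)` acts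
irreducibly on `E`, or again: `U(E)` is transitive on the unit sphere, so an invariant subspace containing one
unit vector contains them all. The isometry used is the REFLECTION in the hyperplane `(𝕜 ∙ (v - w))ᗮ`, which
swaps two orthogonal vectors `v ∈ K`, `w ∈ Kᗮ` of equal norm: `reflection_sub_of_inner_eq_zero`, the `RCLike`
version of Mathlib's real `Submodule.reflection_sub` (over `ℂ` the hypothesis `⟪v, w⟫ = 0` — or at least
`⟪v, w⟫ ∈ ℝ` — is needed). `line_not_invariant` is the rank-one special case (a LINE is moved by some linear
isometry unless `E` is itself a line), e.g. `U(2)` fixes no complex line of `ℂ²`.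

Everything is elementary. [folklore] (Transitivity of `U(n)` on the sphere: W. Rudin, *Function Theory in the
Unit Ball of ℂⁿ*, Springer 1980, §1.4.6–1.4.7, "𝒰 acts transitively on S".)

## Provenance

Staged by the pub-hodgecm formalisation cell (DAG-node prover #03 lineage) under the LEAN-IN-TREE rule; it
supersedes the cell's standalone package file `HodgeCM/PerL34/LineFieldCore.lean` (namespace
`HodgeCM.PerL34.LineFieldCore` ↦ `Literature.Analysis.InnerProduct.IsometryInvariant`, names unchanged). The
matrix form for `SU(2)` on `ℂ²` is the tree's `Literature.LinearAlgebra.Matrix.SU2Line.exists_SU2_moves_line`.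

## Not here

Infinite-dimensional `E` (the statement holds there too, with the same reflection, once `K` is closed);
transitivity of `U(E)` on spheres as such.
-/

set_option autoImplicit false

open scoped InnerProductSpace

namespace Literature.Analysis.InnerProduct

namespace IsometryInvariant

variable {𝕜 E : Type*} [RCLike 𝕜] [NormedAddCommGroup E] [InnerProductSpace 𝕜 E]

/-- The reflection in the hyperplane `(𝕜 ∙ (v - w))ᗮ` maps `v` to `w` when `‖v‖ = ‖w‖` and `⟪v, w⟫_𝕜 = 0`
(over `ℝ` the orthogonality is not needed: `Submodule.reflection_sub`). [folklore] -/
theorem reflection_sub_of_inner_eq_zero {v w : E} [(𝕜 ∙ (v - w))ᗮ.HasOrthogonalProjection]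
    (h : ‖v‖ = ‖w‖) (hvw : ⟪v, w⟫_𝕜 = 0) :
    (𝕜 ∙ (v - w))ᗮ.reflection v = w := by
  set R : E ≃ₗᵢ[𝕜] E := (𝕜 ∙ (v - w))ᗮ.reflection
  suffices hs : R v + R v = w + w by
    have h2 : (2 : 𝕜) • R v = (2 : 𝕜) • w := by simpa [two_smul] using hs
    exact smul_right_injective E (two_ne_zero' 𝕜) h2
  have hwv : ⟪w, v⟫_𝕜 = 0 := by rw [← inner_conj_symm, hvw, map_zero]
  have h₁ : R (v - w) = -(v - w) := Submodule.reflection_orthogonalComplement_singleton_eq_neg (v - w)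
  have h₂ : R (v + w) = v + w := by
    apply Submodule.reflection_mem_subspace_eq_self
    rw [Submodule.mem_orthogonal_singleton_iff_inner_right]
    simp only [inner_sub_left, inner_add_right, hvw, hwv, inner_self_eq_norm_sq_to_K, h]
    ring
  have h₃ : R v + R v = R (v + w) + R (v - w) := by
    rw [map_add, map_sub]; abel
  rw [h₃, h₂, h₁]; abel

/-- **No proper non-zero subspace is invariant under every linear isometry** (finite-dimensional inner
product space over `ℝ` or `ℂ`): if `⊥ ≠ K ≠ ⊤` then some linear isometry moves some vector of `K` out of `K`.
[folklore] -/
theorem exists_linearIsometryEquiv_apply_not_mem [FiniteDimensional 𝕜 E] (K : Submodule 𝕜 E)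
    (hbot : K ≠ ⊥) (htop : K ≠ ⊤) : ∃ g : E ≃ₗᵢ[𝕜] E, ∃ v ∈ K, g v ∉ K := by
  haveI : CompleteSpace K := FiniteDimensional.complete 𝕜 K
  obtain ⟨v, hvK, hv0⟩ := Submodule.exists_mem_ne_zero_of_ne_bot hbot
  have hKo : Kᗮ ≠ ⊥ := fun h => htop (Submodule.orthogonal_eq_bot_iff.mp h)
  obtain ⟨w₀, hw₀K, hw₀0⟩ := Submodule.exists_mem_ne_zero_of_ne_bot hKo
  set c : 𝕜 := ((‖v‖ / ‖w₀‖ : ℝ) : 𝕜) with hc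
  set w : E := c • w₀ with hw
  have hwK : w ∈ Kᗮ := Kᗮ.smul_mem c hw₀K
  have hnorm : ‖v‖ = ‖w‖ := by
    have hw₀n : ‖w₀‖ ≠ 0 := norm_ne_zero_iff.mpr hw₀0
    rw [hw, norm_smul, hc, RCLike.norm_ofReal, abs_of_nonneg (by positivity), div_mul_cancel₀ _ hw₀n]
  have hvw : ⟪v, w⟫_𝕜 = 0 := Submodule.inner_right_of_mem_orthogonal hvK hwK
  haveI : CompleteSpace (𝕜 ∙ (v - w)) := FiniteDimensional.complete 𝕜 _
  refine ⟨(𝕜 ∙ (v - w))ᗮ.reflection, v, hvK, ?_⟩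
  rw [reflection_sub_of_inner_eq_zero hnorm hvw]
  intro hwK'
  have hw0 : w = 0 := by
    have h00 : ⟪w, w⟫_𝕜 = 0 := Submodule.inner_right_of_mem_orthogonal hwK' hwK
    exact inner_self_eq_zero.mp h00
  apply hv0
  rw [← norm_eq_zero, hnorm, hw0, norm_zero]

/-- In a finite-dimensional inner product space that is not itself a line, every LINE is moved by some linear
isometry (e.g. `U(2)` fixes no complex line of `ℂ²`). [folklore] -/
theorem line_not_invariant [FiniteDimensional 𝕜 E] (K : Submodule 𝕜 E)
    (hK : Module.finrank 𝕜 K = 1) (hE : Module.finrank 𝕜 E ≠ 1) :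
    ∃ g : E ≃ₗᵢ[𝕜] E, ∃ v ∈ K, g v ∉ K := by
  refine exists_linearIsometryEquiv_apply_not_mem K ?_ ?_
  · intro h; rw [h, finrank_bot] at hK; exact zero_ne_one hK
  · intro h; rw [h, finrank_top] at hK; exact hE hK

end IsometryInvariant

end Literature.Analysis.InnerProduct
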